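import Literature.AlgebraicGeometry.HodgeTheory.AlgebraicClassesCupDivisor
import Literature.AlgebraicGeometry.HodgeTheory.SupportedClassesPurity
import Literature.AlgebraicGeometry.HodgeTheory.SupportedClassesAdditivity
import Literature.AlgebraicGeometry.HodgeTheory.GAGALocalEquation
import Literature.AlgebraicGeometry.HodgeTheory.GAGAZeroDivisorSupport
import Literature.AlgebraicGeometry.Resolution.RegularLocalRingsUFD
import Literature.AlgebraicGeometry.Motives.VarietiesRegularProofs
import Literature.AlgebraicTopology.SingularHomology.LocallyFlatPairMapLine
import Literature.NumberTheory.Transcendental.AnalytificationChartsProofs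
import HarnessLib

/-!
# The classes supported on a prime divisor die on a Zariski neighbourhood of each of its points (the divisor moves: Lelong–Poincaré for a local equation)

Family `hodge`, layer `Literature/AlgebraicGeometry/HodgeTheory`. Companion of `AlgebraicClassesCupDivisor`
(C. Voisin, *Hodge Theory II* (2003), Prop. 9.20 for a DIVISOR class, reduced by
`cupProduct_mem_algebraicClasses_one_of_forall_primeDivisor'` to moving the classes supported on a prime
divisor `W` away from a point `v ∈ W`; W. Fulton, *Intersection Theory* (1998), §2.3–2.4: the divisor
moves in its linear system) and of `SupportedClassesPurity` (`ker (H²(X) → H²(X ∖ W)) ≤ ℂ · τ_W`).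
This file PROVES the moving in its sharpest local form, on the tree's real carriers
(`complexBetti`, `complexBetti.restrictCompl`):

* `ker_restrictCompl_le_of_mem_primeDivisor` — **for `X` smooth projective over `ℂ`, `W ⊆ X` closed
  irreducible with generic point of codimension `1` and `v ∈ W`, there is a Zariski-open `O ∋ v` with
  `ker (H²(X(ℂ); ℂ) → H²((X ∖ W)(ℂ); ℂ)) ≤ ker (H²(X(ℂ); ℂ) → H²(O(ℂ); ℂ))`.** In print:
  `cl(W)|_O = c₁(𝒪_X(W))|_O = 0` for `O` trivialising the line bundle `𝒪_X(W)` of the Cartier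
  divisor `W` (`X` is locally factorial: Auslander–Buchsbaum, Matsumura Thm. 20.3; Voisin I, proof of
  Thm. 11.33, "`Lᵢ` is trivial on `X − Dᵢ`"); equivalently `[W ∩ O] = [div j] = j^*[0] = 0` in
  `H²(O(ℂ))` for a local equation `j` of the reduced divisor `W` on `O` — the Lelong–Poincaré formula
  `[D] = [f⁻¹(0)]` for `f` with a reduced zero along `D` (Voisin I §11.1.2; Griffiths–Harris p. 141).

The proof assembles three tree inputs.
(1) TOPOLOGY, `ker_restrictCompl_le_of_normalCoordinate`: the tree's topological Lelong–Poincaré lemma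
`ker_cohomologyMap_le_span_map_of_pairMap` (`SingularHomology/LocallyFlatPairMapLine`) on the open
subspace `Y = (O ∖ Z₁)(ℂ)` (`Z₁ ⊆ W` the closed subset of codimension `≥ 2` off which `W(ℂ)` is
straightened, `GAGADimension.exists_closed_straightening_off`) with target the PLANE `ℂ`, base point
`0` and the class `ω = 0` of `H²(ℂ; ℂ)` (`H₂(ℂ) = 0`, `isZero_singularHomology_of_contractibleSpace`):
if `f : O(ℂ) → ℂ` is continuous, vanishes exactly on `W(ℂ)`, and near ONE point of the closed,
preconnected (`W` irreducible, `ComplexPoints.isConnected_setOf_pt_mem_inter_of_isIrreducible`),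
locally flat `S = W(ℂ) ∩ Y` is a non-vanishing multiple of the first coordinate of a straightening
chart, then `ker (H²(Y) → H²(Y ∖ S)) ≤ ℂ · f^*0 = 0`, so the kernel of `W` dies on `Y`.
(2) GAGA, `exists_normalCoordinate_of_chart`: a local equation `(W_c, j_c)` of the reduced divisor `W`
(a `ComplementDivisor.Chart` of `X ∖ W`) is such an `f` on `W_c(ℂ)`: the GAGA local equation
`(W₁, j₁)` with `dj₁ ≠ 0` over `W ∩ W₁` (`exists_chart_mfderiv_ne_zero`, Serre n° 20 Remarque 1, in the
algebraic-chart model of `X^h`, `exists_algebraicChart_holds`), the unit `j_c / j₁ = a / b` on an affine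
neighbourhood of a simple point (`ComplementDivisor.isUnitAt_div`, `RatFn.isRegularAt_iff_exists`), and
the implicit-function chart of the analytic chart expression of `j₁`
(`HasStrictFDerivAt.implicitToOpenPartialHomeomorph`, whose first component is `j₁`).
(3) ALGEBRA: local equations exist at every point (`ComplementDivisor.exists_chart_of_pure` with
`Matsumura1987_20_3_holds` and `height_eq_one_of_mem_minimalPrimes_of_isGenericPoint`); the exceptional
`Z₁` is removed by additivity (`ker_restrictCompl_union_le`) and semipurity
(`injective_restrictCompl_of_le_coheight`).

Everything is proved; no definitions, no named facts. Consumer: the divisor case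
`Nᵃ H²ᵃ ∪ N¹ H² ⊆ Nᵃ⁺¹` of Voisin II Prop. 9.20 on every smooth projective complex variety
(`Summits/HodgeConjecture/HodgeConjecture/Theorems/HeckePrymWeilSummitOffWeilSectorCupProductAlgebraicDivisor`).

## References

* [VoisinHodgeII2003] C. Voisin, Hodge Theory and Complex Algebraic Geometry II (CUP 2003), §9.2.3
  Lemma 9.18 (proof), §9.2.4 Prop. 9.20.
* [VoisinHodgeI2002] C. Voisin, Hodge Theory and Complex Algebraic Geometry I (CUP 2002), §11.1.2,
  Lemma 11.13, Thm. 11.33 (proof).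
* [Fulton1998] W. Fulton, Intersection Theory, 2nd ed. (1998), §2.3–2.4, §19.1 Lemma 19.1.1, §19.2
  Cor. 19.2.
* [SerreGAGA1956] J.-P. Serre, Géométrie algébrique et géométrie analytique, Ann. Inst. Fourier 6
  (1956), §2 n°5 Prop. 2, n°6 Cor. 2, n° 20 Remarque 1.
* [GortzWedhorn2023] U. Görtz, T. Wedhorn, Algebraic Geometry II (2023), Lemma 25.150.
* [GriffithsHarrisPrinciples1978] P. Griffiths, J. Harris, Principles of Algebraic Geometry (1978),
  Ch. 0 §1 (implicit function theorem), p. 141.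
* [Matsumura1987] H. Matsumura, Commutative Ring Theory (1987), Thm. 20.3.
-/

noncomputable section

open scoped Manifold ContDiff Topology
open CategoryTheory AlgebraicGeometry Set TopologicalSpace
open Literature.AlgebraicGeometry.Motives Literature.AlgebraicTopology.SingularHomology
open Literature.Geometry.Kaehler

namespace Literature.AlgebraicGeometry.HodgeTheory

section HodgeTheory

/-! ### The topological core: a closed subvariety with a normal coordinate at one point carries no class -/

/-- **A class supported on an irreducible `W` dies on an open set where `W(ℂ)` has a global
equation which is a normal coordinate at one point** (the topological Lelong–Poincaré formula
`[f⁻¹(0)] = f^*[0] = 0` for `f` with a reduced zero, in the support calculus). Let `X` be smooth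
projective over `ℂ`, `W ⊆ X` closed irreducible, `Z₁` closed such that `W(ℂ)` is straightened in
`X(ℂ)` at every point off `Z₁` (real codimension `≥ 2`), `O ⊆ X` open with `W ∩ O ⊄ Z₁`, and
`f : X(ℂ) → ℂ` continuous on `O(ℂ)` vanishing exactly on `W(ℂ) ∩ O(ℂ)`. Suppose that on the source
(inside `(O ∖ Z₁)(ℂ)`) of ONE chart `e₀ : X(ℂ) ⇀ ℂ × K₀` at a point `s₀` of `W(ℂ)` straightening
`W(ℂ)`, `f = cf · (e₀ ·).1` with `cf` continuous and nowhere zero. Then every class of `H²(X(ℂ); ℂ)`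
vanishing on `(X ∖ W)(ℂ)` vanishes on `(O ∖ Z₁)(ℂ)`: on `Y = (O ∖ Z₁)(ℂ)` the classes dying off the
closed, preconnected, locally flat `S = W(ℂ) ∩ Y` span at most the line `ℂ · f^*ω`, `ω` a class of
`H²(ℂ; ℂ) = 0` (`ker_cohomologyMap_le_span_map_of_pairMap` with `P = ℂ`, `p₀ = 0`, `j = id`).
[cite: VoisinHodgeI2002, §11.1.2 and Thm. 11.33 (proof)] [cite: Fulton1998, §19.1 Lemma 19.1.1] -/
theorem ker_restrictCompl_le_of_normalCoordinate {n : ℕ} {X : SchemeOver ℂ}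
    (hX : IsSmoothProjective n X) {W : Set X.left} (hW : IsClosed W) (hWi : IsIrreducible W)
    {Z₁ : Set X.left} (hZ₁ : IsClosed Z₁)
    (hstr : ∀ P : ComplexPoints X, P.pt ∈ W → P.pt ∉ Z₁ →
      ∃ (c' : ℕ) (K : Submodule ℂ (Fin n → ℂ))
        (e : OpenPartialHomeomorph (ComplexPoints X) ((Fin c' → ℂ) × K)),
        1 ≤ c' ∧ P ∈ e.source ∧ ∀ Q ∈ e.source, Q.pt ∈ W ↔ (e Q).1 = 0)
    (O : X.left.Opens) (hWO : ∃ z ∈ W, z ∈ (O : Set X.left) ∧ z ∉ Z₁)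
    {f : ComplexPoints X → ℂ} (hf : ContinuousOn f {P | P.pt ∈ O})
    (hf0 : ∀ P : ComplexPoints X, P.pt ∈ O → (f P = 0 ↔ P.pt ∈ W))
    {K₀ : Type} [NormedAddCommGroup K₀] [NormedSpace ℝ K₀]
    (e₀ : OpenPartialHomeomorph (ComplexPoints X) (ℂ × K₀))
    (he₀ : e₀.source ⊆ {P | P.pt ∈ O ∧ P.pt ∉ Z₁})
    (he₀W : ∀ P ∈ e₀.source, P.pt ∈ W ↔ (e₀ P).1 = 0)
    {s₀ : ComplexPoints X} (hs₀ : s₀ ∈ e₀.source) (hs₀W : s₀.pt ∈ W)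
    {cf : ComplexPoints X → ℂ} (hcf : ContinuousOn cf e₀.source)
    (hcf0 : ∀ P ∈ e₀.source, cf P ≠ 0) (hfe : ∀ P ∈ e₀.source, f P = cf P * (e₀ P).1) :
    LinearMap.ker (complexBetti.restrictCompl X W 2).hom ≤
      LinearMap.ker (complexBetti.restrictCompl X ((O : Set X.left)ᶜ ∪ Z₁) 2).hom := by
  -- instances on `X(ℂ)`
  haveI := hX.smoothOfRelativeDimension
  haveI : LocallyOfFiniteType X.hom := by
    haveI : Smooth X.hom := SmoothOfRelativeDimension.smooth n _
    infer_instance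
  haveI := IsSmoothProjective.compactSpace_holds hX
  haveI : SecondCountableTopology (ComplexPoints X) :=
    ComplexPoints.secondCountableTopology_of_compactSpace_holds X
  -- the closed set `Z = (X ∖ O) ∪ Z₁`, the open subspace `Y = (X ∖ Z)(ℂ)` and `S = W(ℂ) ∩ Y`
  set Z : Set X.left := (O : Set X.left)ᶜ ∪ Z₁ with hZdef
  have hZ : IsClosed Z := O.2.isClosed_compl.union hZ₁
  have hmemZ : ∀ P : ComplexPoints X, P.pt ∉ Z ↔ P.pt ∈ O ∧ P.pt ∉ Z₁ := fun P ↦ by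
    simp only [hZdef, Set.mem_union, Set.mem_compl_iff, not_or, not_not, SetLike.mem_coe]
  have hOY : IsOpen {P : ComplexPoints X | P.pt ∉ Z} := isOpen_setOf_pt_not_mem hZ
  set S : Set (complexPointsCompl X Z) := {Q | Q.1.pt ∈ W} with hSdef
  have hS : IsClosed S := by
    have h1 : IsClosed {P : ComplexPoints X | P.pt ∈ W} :=
      ⟨AlgPoints.isOpen_setOf_pt_mem (X := X) (L := ℂ) ⟨Wᶜ, hW.isOpen_compl⟩⟩
    exact h1.preimage continuous_subtype_val
  -- `S` is preconnected (`W` is irreducible)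
  have hSc : IsPreconnected S := by
    obtain ⟨z, hzW, hzO, hzZ₁⟩ := hWO
    have hzZ : z ∉ Z := fun h ↦ h.elim (fun h' ↦ h' hzO) fun h' ↦ hzZ₁ h'
    have hconn := ComplexPoints.isConnected_setOf_pt_mem_inter_of_isIrreducible X hW hWi
      ⟨Zᶜ, hZ.isOpen_compl⟩ ⟨z, hzW, hzZ⟩
    have himg : (Subtype.val : complexPointsCompl X Z → ComplexPoints X) '' S =
        {P : ComplexPoints X | P.pt ∈ W ∧
          P.pt ∈ ((⟨Zᶜ, hZ.isOpen_compl⟩ : X.left.Opens) : Set X.left)} := by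
      ext P
      constructor
      · rintro ⟨Q, hQ, rfl⟩
        exact ⟨hQ, Q.2⟩
      · rintro ⟨hPW, hPZ⟩
        exact ⟨⟨P, hPZ⟩, hPW, rfl⟩
    have hind : Topology.IsInducing (Subtype.val : complexPointsCompl X Z → ComplexPoints X) :=
      ⟨rfl⟩
    rw [← hind.isPreconnected_image, himg]
    exact hconn.isPreconnected
  -- local flatness of `S` in `Y`, of real codimension `≥ 2`
  have hflat : ∀ x ∈ S, ∃ (F : Type) (_ : NormedAddCommGroup F) (_ : NormedSpace ℝ F)
      (_ : FiniteDimensional ℝ F) (K : Type) (_ : NormedAddCommGroup K) (_ : NormedSpace ℝ K)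
      (e : OpenPartialHomeomorph (complexPointsCompl X Z) (F × K)),
      2 ≤ Module.finrank ℝ F ∧ x ∈ e.source ∧ ∀ z ∈ e.source, z ∈ S ↔ (e z).1 = 0 := by
    intro x hx
    obtain ⟨c', K, e, hcc', hxe, he⟩ := hstr x.1 hx ((hmemZ x.1).1 x.2).2
    let s : TopologicalSpace.Opens (ComplexPoints X) := ⟨{P | P.pt ∉ Z}, hOY⟩
    let e' : OpenPartialHomeomorph (complexPointsCompl X Z) ((Fin c' → ℂ) × ↥K) :=
      e.subtypeRestr (s := s) ⟨x⟩
    have he's : e'.source = Subtype.val ⁻¹' e.source :=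
      OpenPartialHomeomorph.subtypeRestr_source e ⟨x⟩
    have he'a : ∀ z : complexPointsCompl X Z, e' z = e z.1 := fun z ↦ rfl
    refine ⟨Fin c' → ℂ, inferInstance, inferInstance, inferInstance, ↥K, inferInstance,
      inferInstance, e', ?_, ?_, fun z hz ↦ ?_⟩
    · have hfr : Module.finrank ℝ (Fin c' → ℂ) = 2 * c' := by
        rw [Module.finrank_pi_fintype, Finset.sum_const, Finset.card_univ, Fintype.card_fin,
          Complex.finrank_real_complex, smul_eq_mul, mul_comm]
      rw [hfr]
      omega
    · rw [he's]
      exact hxe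
    · rw [he's] at hz
      rw [he'a]
      exact he z.1 hz
  -- the map `Φ = f|_Y : Y → ℂ`, non-zero off `S`
  let Φ : C(complexPointsCompl X Z, ℂ) :=
    ⟨fun Q ↦ f Q.1, hf.comp_continuous continuous_subtype_val fun Q ↦ ((hmemZ Q.1).1 Q.2).1⟩
  have hΦ : Set.MapsTo Φ Sᶜ ({0}ᶜ : Set ℂ) := by
    intro Q hQ h0
    exact hQ ((hf0 Q.1 ((hmemZ Q.1).1 Q.2).1).1 h0)
  -- the special chart at `s₀`, read in `Y`
  have hs₀Z : s₀.pt ∉ Z := (hmemZ s₀).2 (he₀ hs₀)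
  let s : TopologicalSpace.Opens (ComplexPoints X) := ⟨{P | P.pt ∉ Z}, hOY⟩
  let y₀ : complexPointsCompl X Z := ⟨s₀, hs₀Z⟩
  let e₀' : OpenPartialHomeomorph (complexPointsCompl X Z) (ℂ × K₀) :=
    e₀.subtypeRestr (s := s) ⟨y₀⟩
  have he₀'s : e₀'.source = Subtype.val ⁻¹' e₀.source :=
    OpenPartialHomeomorph.subtypeRestr_source e₀ ⟨y₀⟩
  have he₀'a : ∀ z : complexPointsCompl X Z, e₀' z = e₀ z.1 := fun z ↦ rfl
  have he₀'S : ∀ z ∈ e₀'.source, z ∈ S ↔ (e₀' z).1 = 0 := by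
    intro z hz
    rw [he₀'s] at hz
    rw [he₀'a]
    exact he₀W z.1 hz
  have hy₀ : y₀ ∈ e₀'.source := by
    rw [he₀'s]
    exact hs₀
  have hy₀S : y₀ ∈ S := hs₀W
  -- `H₂(ℂ; ℂ) = 0`: the class `ω = 0 ∈ H²(ℂ)` pairs as required (vacuously)
  have hω : ∀ u : singularHomology ℂ ℂ ℂ 2,
      relativeSingularHomology.ofAbsolute ℂ ℂ ℂ ({(0 : ℂ)}ᶜ : Set ℂ) 2 u ≠ 0 →
        kroneckerPairing ℂ ℂ ℂ 2 (0 : singularCohomology ℂ ℂ ℂ 2) u ≠ 0 := by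
    intro u hu
    exfalso
    apply hu
    have hZ0 := isZero_singularHomology_of_contractibleSpace ℂ ℂ (X := ℂ) two_ne_zero
    have h1 : (𝟙 (singularHomology ℂ ℂ ℂ 2) : _ ⟶ _) = 0 := hZ0.eq_of_src _ _
    have h0 : u = 0 := by
      have h2 := congrArg (fun φ : singularHomology ℂ ℂ ℂ 2 ⟶ singularHomology ℂ ℂ ℂ 2 ↦ φ u) h1
      simpa using h2
    rw [h0, map_zero]
  have hω0 : singularCohomology.map ℂ ℂ (subsetIncl ({(0 : ℂ)}ᶜ : Set ℂ)) 2
      (0 : singularCohomology ℂ ℂ ℂ 2) = 0 := map_zero _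
  -- the topological Lelong–Poincaré lemma: the supported line is spanned by `Φ^* 0 = 0`
  haveI : SecondCountableTopology (complexPointsCompl X Z) :=
    inferInstanceAs (SecondCountableTopology ↥{P : ComplexPoints X | P.pt ∉ Z})
  have key := ker_cohomologyMap_le_span_map_of_pairMap ℂ hS hSc hflat Φ hΦ 0 hω0 hω e₀' he₀'S
    hy₀ hy₀S Topology.IsOpenEmbedding.id rfl (c := fun z ↦ cf z.1)
    (hcf.comp continuous_subtype_val.continuousOn fun z hz ↦ by rwa [he₀'s] at hz)
    (fun z hz ↦ hcf0 z.1 (by rwa [he₀'s] at hz))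
    (fun z hz ↦ by
      rw [he₀'s] at hz
      change f z.1 = id (cf z.1 * (e₀ z.1).1)
      exact hfe z.1 hz)
  rw [map_zero] at key
  -- conclusion: a class dying off `W` dies on `Y`
  intro x hx
  have hx' : complexBetti.restrictCompl X W 2 x = 0 := LinearMap.mem_ker.1 hx
  rw [LinearMap.mem_ker]
  change complexBetti.restrictCompl X Z 2 x = 0
  -- the restriction of `x|_Y` to `Y ∖ S` factors through `(X ∖ W)(ℂ)`, where `x` dies
  let k : C(↥Sᶜ, complexPointsCompl X W) := ⟨fun Q ↦ ⟨Q.1.1, Q.2⟩, by fun_prop⟩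
  have hfac : (⟨Subtype.val, continuous_subtype_val⟩ :
      C(complexPointsCompl X Z, ComplexPoints X)).comp (subsetIncl Sᶜ) =
      (⟨Subtype.val, continuous_subtype_val⟩ :
        C(complexPointsCompl X W, ComplexPoints X)).comp k :=
    ContinuousMap.ext fun _ ↦ rfl
  have hmem : complexBetti.restrictCompl X Z 2 x ∈
      LinearMap.ker (singularCohomology.map ℂ ℂ (subsetIncl Sᶜ) 2).hom := by
    rw [LinearMap.mem_ker]
    change (complexBetti.restrictCompl X Z 2 ≫ singularCohomology.map ℂ ℂ (subsetIncl Sᶜ) 2) x = 0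
    rw [complexBetti.restrictCompl, ← singularCohomology.map_comp, hfac, singularCohomology.map_comp,
      ModuleCat.comp_apply]
    change singularCohomology.map ℂ ℂ k 2 (complexBetti.restrictCompl X W 2 x) = 0
    rw [hx', map_zero]
  obtain ⟨a, ha⟩ := Submodule.mem_span_singleton.1 (key hmem)
  rw [smul_zero] at ha
  exact ha.symm

/-! ### The local datum: a local equation of a prime divisor is a normal coordinate near a simple point -/

/-- **Near a simple point of a prime divisor `W`, any local equation of `W` is a non-vanishing
multiple of a normal coordinate** (Serre, GAGA n° 20 Remarque 1 with §2 n°6 Cor. 2: the algebraic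
local equation of a subvariety at a simple point is an analytic local coordinate; two local
equations of the reduced divisor differ by a unit, Görtz–Wedhorn II Lemma 25.150). Let `X` be smooth
projective of dimension `n` over `ℂ`, `W ⊆ X` closed irreducible with generic point `η` of
codimension `1`, `(W_c, j_c)` a local equation of the reduced divisor `W` (a
`ComplementDivisor.Chart` of `X ∖ W`) with `η ∈ W_c`, and `Z₁` a closed subset of codimension `≥ 2`.
Then there are a complex point `s₀` of `W ∩ W_c ∖ Z₁`, an open partial homeomorphism
`e₀ : X(ℂ) ⇀ ℂ × K₀` (strong topology) at `s₀` with source inside `(W_c ∖ Z₁)(ℂ)` whose first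
coordinate vanishes exactly over `W`, and a continuous nowhere-zero `cf` on its source with
`j_c(P) = cf(P) · (e₀ P).1`. Construction: the GAGA local equation `(W₁, j₁)` of `W` with
`dj₁ ≠ 0` over `W ∩ W₁` (`exists_chart_mfderiv_ne_zero`, in the algebraic-chart model of `X^h`,
`exists_algebraicChart_holds`); a complex point `s₀` of the non-empty `W ∩ W_c ∩ W₁ ∖ Z₁`
(`ComplexPoints.isConnected_setOf_pt_mem_inter_of_isIrreducible`); on an affine `V ∋ s₀` the unit
`j_c / j₁ = a / b` (`ComplementDivisor.isUnitAt_div`, `RatFn.isRegularAt_iff_exists`), so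
`j_c · b = a · j₁` in `Γ(X, V)` and at complex points; and the implicit-function chart of the
analytic chart expression of `j₁` at `s₀` (`HasStrictFDerivAt.implicitToOpenPartialHomeomorph`, whose
first component is `j₁`). [cite: SerreGAGA1956, §2 n°6 Cor. 2 and n° 20 Remarque 1]
[cite: GortzWedhorn2023, Lemma 25.150 (p. 670)] [cite: GriffithsHarrisPrinciples1978, Ch. 0 §1, implicit function theorem] -/
theorem exists_normalCoordinate_of_chart {n : ℕ} {X : SchemeOver ℂ} (hX : IsSmoothProjective n X)
    [IsIntegral X.left] {W : Set X.left} (hW : IsClosed W) (hWi : IsIrreducible W)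
    (hη : Order.coheight hWi.genericPoint = 1)
    (c : ComplementDivisor.Chart (⟨Wᶜ, hW.isOpen_compl⟩ : X.left.Opens))
    (hηc : hWi.genericPoint ∈ c.W) {Z₁ : Set X.left} (hZ₁ : IsClosed Z₁)
    (hcZ₁ : ∀ z ∈ Z₁, ((2 : ℕ) : ℕ∞) ≤ Order.coheight z) :
    ∃ (K₀ : Submodule ℂ (Fin n → ℂ)) (e₀ : OpenPartialHomeomorph (ComplexPoints X) (ℂ × ↥K₀))
      (s₀ : ComplexPoints X) (cf : ComplexPoints X → ℂ),
      e₀.source ⊆ {P | P.pt ∈ c.W ∧ P.pt ∉ Z₁} ∧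
      (∀ P ∈ e₀.source, P.pt ∈ W ↔ (e₀ P).1 = 0) ∧ s₀ ∈ e₀.source ∧ s₀.pt ∈ W ∧
      ContinuousOn cf e₀.source ∧ (∀ P ∈ e₀.source, cf P ≠ 0) ∧
      ∀ P ∈ e₀.source, AlgPoints.evalOrZero c.W c.j P = cf P * (e₀ P).1 := by
  classical
  haveI := hX.smoothOfRelativeDimension
  haveI : LocallyOfFiniteType X.hom := by
    haveI : Smooth X.hom := SmoothOfRelativeDimension.smooth n _
    infer_instance
  have hgen := hWi.isGenericPoint_genericPoint hW
  set η := hWi.genericPoint with hηdef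
  -- Step 1: the algebraic-chart model of `X^h` on `X(ℂ)`, an analytification via `id`
  choose chart mem alg hol using fun P : ComplexPoints X ↦
    Literature.NumberTheory.Transcendental.exists_algebraicChart_holds X n P
  letI cs : ChartedSpace (Fin n → ℂ) (ComplexPoints X) :=
    Literature.NumberTheory.Transcendental.chartedSpaceOfCharts chart mem
  haveI hM₀ : IsManifold 𝓘(ℂ, Fin n → ℂ) ω (ComplexPoints X) :=
    Literature.NumberTheory.Transcendental.isManifold_chartedSpaceOfCharts chart mem alg hol
  have hid : Literature.NumberTheory.Transcendental.IsAnalytification (Fin n → ℂ) X n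
      (id : ComplexPoints X → ComplexPoints X) := by
    refine ⟨IsHomeomorph.id, by simp, ?_⟩
    intro U' s m hm
    simp only [Set.preimage_id_eq, id_eq, Set.mem_setOf_eq] at hm
    refine MDifferentiableAt.mdifferentiableWithinAt ?_
    rw [mdifferentiableAt_iff]
    refine ⟨(AlgPoints.continuousOn_evalOrZero _ s).continuousAt
      ((AlgPoints.isOpen_setOf_pt_mem _).mem_nhds hm), ?_⟩
    simp only [writtenInExtChartAt, extChartAt, OpenPartialHomeomorph.extend,
      modelWithCornersSelf_partialEquiv, PartialEquiv.trans_refl, modelWithCornersSelf_coe,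
      Set.range_id, OpenPartialHomeomorph.toFun_eq_coe,
      OpenPartialHomeomorph.coe_toPartialEquiv_symm]
    refine DifferentiableAt.differentiableWithinAt ?_
    have hopen : IsOpen ((chart m).target ∩ (chart m).symm ⁻¹' {Q | Q.pt ∈ (↑U' : X.left.Opens)}) :=
      (chart m).isOpen_inter_preimage_symm (AlgPoints.isOpen_setOf_pt_mem _)
    have hmem : chart m m ∈ (chart m).target ∩ (chart m).symm ⁻¹' {Q | Q.pt ∈ (↑U' : X.left.Opens)} :=
      ⟨(chart m).map_source (mem m), by
        simp only [Set.mem_preimage, Set.mem_setOf_eq, (chart m).left_inv (mem m)]; exact hm⟩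
    exact ((hol m U' s).differentiableOn (by simp)).differentiableAt (hopen.mem_nhds hmem)
  -- Step 2: the GAGA local equation `(W₁, j₁)` of `W`: `dj₁ ≠ 0` over `W ∩ W₁`
  obtain ⟨c₁, hηc₁, hd⟩ := exists_chart_mfderiv_ne_zero hX hid hW hgen hη
  -- Step 3: a complex point `s₀` of `W` in `W_c ∩ W₁ ∖ Z₁`
  have hηZ₁ : η ∉ Z₁ := by
    intro h
    have h2 : ((2 : ℕ) : ℕ∞) ≤ Order.coheight η := hcZ₁ η h
    rw [hη] at h2
    exact absurd (by exact_mod_cast h2 : (2 : ℕ) ≤ 1) (by omega)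
  let O₁ : X.left.Opens := c.W ⊓ c₁.W ⊓ ⟨Z₁ᶜ, hZ₁.isOpen_compl⟩
  have hηO₁ : η ∈ (O₁ : Set X.left) := ⟨⟨hηc, hηc₁⟩, hηZ₁⟩
  obtain ⟨s₀, hs₀W, hs₀O₁⟩ := (ComplexPoints.isConnected_setOf_pt_mem_inter_of_isIrreducible X hW
    hWi O₁ ⟨η, hgen.mem, hηO₁⟩).nonempty
  obtain ⟨⟨hs₀c, hs₀c₁⟩, hs₀Z₁⟩ := hs₀O₁
  -- Step 4: an affine open `V ∋ s₀.pt` inside `O₁`, and the unit `j_c / j₁ = a / b` on it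
  obtain ⟨V, hV, hs₀V, hVO₁⟩ := exists_isAffineOpen_mem_and_subset (X := X.left) (U := O₁)
    (x := s₀.pt) (show s₀.pt ∈ O₁ from ⟨⟨hs₀c, hs₀c₁⟩, hs₀Z₁⟩)
  have hVc : V ≤ c.W := fun z hz ↦ (hVO₁ hz).1.1
  have hVc₁ : V ≤ c₁.W := fun z hz ↦ (hVO₁ hz).1.2
  have hVZ₁ : ∀ z ∈ V, z ∉ Z₁ := fun z hz ↦ (hVO₁ hz).2
  haveI : Nonempty V := ⟨⟨s₀.pt, hs₀V⟩⟩
  have hunit : RatFn.IsUnitAt s₀.pt (c.fn / c₁.fn) :=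
    ComplementDivisor.isUnitAt_div c c₁ hs₀c hs₀c₁
  obtain ⟨a, b, hb, hab⟩ :=
    (RatFn.isRegularAt_iff_exists hV ⟨s₀.pt, hs₀V⟩ _).1 hunit.isRegularAt
  have ha : a ∉ (hV.primeIdealOf ⟨s₀.pt, hs₀V⟩).asIdeal := by
    rw [← RatFn.isUnitAt_algebraMap_iff hV ⟨s₀.pt, hs₀V⟩ a, ← hab]
    exact hunit.mul ((RatFn.isUnitAt_algebraMap_iff hV ⟨s₀.pt, hs₀V⟩ b).2 hb)
  have hc₁0 : c₁.fn ≠ 0 := c₁.ne_zero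
  -- the identity `j_c|_V · b = a · j₁|_V` in `Γ(X, V)`
  have hsec : X.left.presheaf.map (homOfLE hVc).op c.j * b =
      a * X.left.presheaf.map (homOfLE hVc₁).op c₁.j := by
    apply RatFn.algebraMap_injective (X := X.left) (V := V)
    rw [map_mul, map_mul, ← c.fn_eq_of_le hVc, ← c₁.fn_eq_of_le hVc₁, ← hab]
    field_simp
  -- Step 5: read at complex points: `j_c(P) b(P) = a(P) j₁(P)` on `V(ℂ)`; `a, b ≠ 0` on `D(a) ∩ D(b)`
  let f : ComplexPoints X → ℂ := fun P ↦ AlgPoints.evalOrZero c.W c.j P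
  let f₁ : ComplexPoints X → ℂ := fun P ↦ AlgPoints.evalOrZero c₁.W c₁.j P
  let aP : ComplexPoints X → ℂ := fun P ↦ AlgPoints.evalOrZero V a P
  let bP : ComplexPoints X → ℂ := fun P ↦ AlgPoints.evalOrZero V b P
  have hrel : ∀ P : ComplexPoints X, P.pt ∈ V → f P * bP P = aP P * f₁ P := by
    intro P hP
    have h := congrArg (fun σ ↦ AlgPoints.evalOrZero V σ P) hsec
    simp only [evalOrZero_mul_apply] at h
    rwa [AlgPoints.evalOrZero_map_homOfLE hVc c.j hP, AlgPoints.evalOrZero_map_homOfLE hVc₁ c₁.j hP]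
      at h
  let V' : X.left.Opens := V ⊓ X.left.basicOpen a ⊓ X.left.basicOpen b
  have hs₀V' : s₀.pt ∈ (V' : Set X.left) :=
    ⟨⟨hs₀V, (GAGADimension.mem_basicOpen_iff_notMem_primeIdealOf hV ⟨_, hs₀V⟩ a).2 ha⟩,
      (GAGADimension.mem_basicOpen_iff_notMem_primeIdealOf hV ⟨_, hs₀V⟩ b).2 hb⟩
  have haP : ∀ P : ComplexPoints X, P.pt ∈ (V' : Set X.left) → aP P ≠ 0 := by
    intro P hP
    change AlgPoints.evalOrZero V a P ≠ 0
    rw [AlgPoints.evalOrZero_of_mem a hP.1.1]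
    exact (AlgPoints.pt_mem_basicOpen_iff P hP.1.1 a).1 hP.1.2
  have hbP : ∀ P : ComplexPoints X, P.pt ∈ (V' : Set X.left) → bP P ≠ 0 := by
    intro P hP
    change AlgPoints.evalOrZero V b P ≠ 0
    rw [AlgPoints.evalOrZero_of_mem b hP.1.1]
    exact (AlgPoints.pt_mem_basicOpen_iff P hP.1.1 b).1 hP.2
  -- Step 6: the straightening chart with first coordinate `j₁` at `s₀` (implicit functions)
  set φ₀ := chart s₀ with hφ₀
  have hs₀φ : s₀ ∈ φ₀.source := mem s₀
  have hg : ContDiffOn ℂ ω (f₁ ∘ φ₀.symm) (φ₀.target ∩ φ₀.symm ⁻¹' {P | P.pt ∈ c₁.W}) :=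
    hol s₀ ⟨c₁.W, c₁.affine⟩ c₁.j
  have hopen : IsOpen (φ₀.target ∩ φ₀.symm ⁻¹' {P : ComplexPoints X | P.pt ∈ c₁.W}) :=
    φ₀.isOpen_inter_preimage_symm (AlgPoints.isOpen_setOf_pt_mem _)
  have hmem₀ : φ₀ s₀ ∈ φ₀.target ∩ φ₀.symm ⁻¹' {P : ComplexPoints X | P.pt ∈ c₁.W} := by
    refine ⟨φ₀.map_source hs₀φ, ?_⟩
    change (φ₀.symm (φ₀ s₀)).pt ∈ c₁.W
    rw [φ₀.left_inv hs₀φ]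
    exact hs₀c₁
  have h1 : ContDiffAt ℂ 1 (f₁ ∘ φ₀.symm) (φ₀ s₀) :=
    (hg.contDiffAt (hopen.mem_nhds hmem₀)).of_le le_top
  have hstrict : HasStrictFDerivAt (f₁ ∘ φ₀.symm) (fderiv ℂ (f₁ ∘ φ₀.symm) (φ₀ s₀)) (φ₀ s₀) :=
    h1.hasStrictFDerivAt one_ne_zero
  set g' := fderiv ℂ (f₁ ∘ φ₀.symm) (φ₀ s₀) with hg'def
  -- `g' ≠ 0`: it is the `mfderiv` of `j₁` at the point `s₀` of `W ∩ W₁`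
  have hmd : MDifferentiableOn 𝓘(ℂ, Fin n → ℂ) 𝓘(ℂ, ℂ) f₁ {P : ComplexPoints X | P.pt ∈ c₁.W} :=
    hid.mdifferentiableOn_evalOrZero ⟨c₁.W, c₁.affine⟩ c₁.j
  have hmdQ : MDifferentiableAt 𝓘(ℂ, Fin n → ℂ) 𝓘(ℂ, ℂ) f₁ s₀ :=
    hmd.mdifferentiableAt ((AlgPoints.isOpen_setOf_pt_mem c₁.W).mem_nhds hs₀c₁)
  have hg'ne : g' ≠ 0 := by
    have heq : mfderiv 𝓘(ℂ, Fin n → ℂ) 𝓘(ℂ, ℂ) f₁ s₀ = g' := by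
      rw [hg'def, hmdQ.mfderiv, ModelWithCorners.range_eq_univ, fderivWithin_univ]
      rfl
    rw [← heq]
    exact hd s₀ hs₀c₁ hs₀W
  have hg'top : g'.range = ⊤ := by
    obtain ⟨v, hv⟩ : ∃ v, g' v ≠ 0 := by
      by_contra h
      push Not at h
      exact hg'ne (ContinuousLinearMap.ext fun v ↦ by rw [h v]; rfl)
    refine LinearMap.range_eq_top.2 fun w ↦ ⟨(w / g' v) • v, ?_⟩
    change g' ((w / g' v) • v) = w
    rw [map_smul, smul_eq_mul, div_mul_cancel₀ w hv]
  let ψ := hstrict.implicitToOpenPartialHomeomorph (f₁ ∘ φ₀.symm) g' hg'top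
  set W₀ : Set (ComplexPoints X) := {P | P.pt ∈ (V' : Set X.left)} with hW₀def
  have hW₀ : IsOpen W₀ := AlgPoints.isOpen_setOf_pt_mem V'
  let e₀ : OpenPartialHomeomorph (ComplexPoints X) (ℂ × ↥g'.ker) := (φ₀.restrOpen W₀ hW₀).trans ψ
  have he₀s : e₀.source ⊆ φ₀.source ∩ W₀ := by
    intro P hP
    rw [OpenPartialHomeomorph.trans_source, OpenPartialHomeomorph.restrOpen_source] at hP
    exact hP.1
  have he₀fst : ∀ P ∈ e₀.source, (e₀ P).1 = f₁ P := by
    intro P hP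
    have hPφ : P ∈ φ₀.source := (he₀s hP).1
    change (ψ (φ₀ P)).1 = f₁ P
    rw [hstrict.implicitToOpenPartialHomeomorph_fst hg'top]
    change f₁ (φ₀.symm (φ₀ P)) = f₁ P
    rw [φ₀.left_inv hPφ]
  have hs₀e₀ : s₀ ∈ e₀.source := by
    rw [OpenPartialHomeomorph.trans_source, OpenPartialHomeomorph.restrOpen_source]
    exact ⟨⟨hs₀φ, hs₀V'⟩, hstrict.mem_implicitToOpenPartialHomeomorph_source hg'top⟩
  -- Step 7: the datum
  refine ⟨g'.ker, e₀, s₀, fun P ↦ aP P / bP P, ?_, ?_, hs₀e₀, hs₀W, ?_, ?_, ?_⟩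
  · intro P hP
    have hPV' : P.pt ∈ (V' : Set X.left) := (he₀s hP).2
    exact ⟨hVc hPV'.1.1, hVZ₁ _ hPV'.1.1⟩
  · intro P hP
    have hPV' : P.pt ∈ (V' : Set X.left) := (he₀s hP).2
    rw [he₀fst P hP]
    change P.pt ∈ W ↔ AlgPoints.evalOrZero c₁.W c₁.j P = 0
    rw [evalOrZero_chart_eq_zero_iff c₁ (hVc₁ hPV'.1.1)]
    change P.pt ∈ W ↔ ¬ (P.pt ∉ W)
    rw [not_not]
  · have hca : ContinuousOn aP W₀ :=
      (AlgPoints.continuousOn_evalOrZero V a).mono fun P hP ↦ hP.1.1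
    have hcb : ContinuousOn bP W₀ :=
      (AlgPoints.continuousOn_evalOrZero V b).mono fun P hP ↦ hP.1.1
    exact (hca.div hcb fun P hP ↦ hbP P hP).mono fun P hP ↦ (he₀s hP).2
  · intro P hP
    have hPV' : P.pt ∈ (V' : Set X.left) := (he₀s hP).2
    exact div_ne_zero (haP P hPV') (hbP P hPV')
  · intro P hP
    have hPV' : P.pt ∈ (V' : Set X.left) := (he₀s hP).2
    rw [he₀fst P hP]
    change f P = aP P / bP P * f₁ P
    rw [div_mul_eq_mul_div, eq_div_iff (hbP P hPV')]
    exact hrel P hPV'.1.1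

/-! ### The classes supported on a prime divisor die near each of its points -/

/-- **A class supported on a prime divisor `W` dies on a Zariski neighbourhood of any point of
`W`** (the divisor moves away from the point: Fulton §2.3–2.4; in Hodge-theoretic terms
`cl(W)|_U = c₁(𝒪_V(W))|_U = 0` on an open `U ∋ v` trivialising `𝒪_V(W)`, Voisin I proof of
Thm. 11.33). For `X` smooth projective over `ℂ`, `W ⊆ X` closed irreducible with generic point of
codimension `1` and `v ∈ W`, there is an open `O ∋ v` with
`ker (H²(X(ℂ)) → H²((X ∖ W)(ℂ))) ≤ ker (H²(X(ℂ)) → H²(O(ℂ)))`. Proof: `X` is locally factorial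
(`Matsumura1987_20_3_holds`) and `W` is pure of codimension one on affine charts
(`height_eq_one_of_mem_minimalPrimes_of_isGenericPoint`), so `W` has a local equation `(W_c, j_c)`
at `v` (`ComplementDivisor.exists_chart_of_pure`); take `O = W_c`. Off the closed `Z₁ ⊆ W` of
codimension `≥ 2` of `GAGADimension.exists_closed_straightening_off`, `j_c` is a normal coordinate
of `W(ℂ)` near a simple point (`exists_normalCoordinate_of_chart`), so the kernel of `W` dies on
`(W_c ∖ Z₁)(ℂ)` (`ker_restrictCompl_le_of_normalCoordinate`); `Z₁` is removed by additivity
(`ker_restrictCompl_union_le`) and semipurity (`injective_restrictCompl_of_le_coheight`).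
[cite: VoisinHodgeI2002, §11.1.2 Lemma 11.13 and Thm. 11.33 (proof)]
[cite: Fulton1998, §2.3–2.4 and §19.2 Cor. 19.2] [cite: GortzWedhorn2023, Lemma 25.150 (p. 670)] -/
theorem ker_restrictCompl_le_of_mem_primeDivisor {n : ℕ} {X : SchemeOver ℂ}
    (hX : IsSmoothProjective n X) {W : Set X.left} (hW : IsClosed W) (hWi : IsIrreducible W)
    (hη : Order.coheight hWi.genericPoint = 1) {v : X.left} (hv : v ∈ W) :
    ∃ O : X.left.Opens, v ∈ O ∧
      LinearMap.ker (complexBetti.restrictCompl X W 2).hom ≤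
        LinearMap.ker (complexBetti.restrictCompl X ((O : Set X.left)ᶜ) 2).hom := by
  classical
  haveI : IsIntegral X.left := IsSmoothProjective.isIntegral_holds hX
  haveI := hX.smoothOfRelativeDimension
  haveI : LocallyOfFiniteType X.hom := by
    haveI : Smooth X.hom := SmoothOfRelativeDimension.smooth n _
    infer_instance
  haveI := IsSmoothProjective.isLocallyNoetherian_holds hX
  have hgen := hWi.isGenericPoint_genericPoint hW
  -- `W ≠ X`: the generic point of `W` has codimension `1`, not `0`
  set UW : X.left.Opens := ⟨Wᶜ, hW.isOpen_compl⟩ with hUW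
  haveI : Nonempty UW := by
    by_contra hne
    have hall : ∀ z : X.left, z ∈ W := fun z ↦ by
      by_contra hz
      exact hne ⟨⟨z, hz⟩⟩
    have hmax : IsMax hWi.genericPoint := fun b _ ↦
      Scheme.le_iff_specializes.2 (hgen.specializes (hall b))
    have h0 : Order.coheight hWi.genericPoint = 0 := Order.coheight_eq_zero.2 hmax
    rw [hη] at h0
    exact one_ne_zero h0
  -- `X` is locally factorial and `W` is pure of codimension one: a local equation of `W` at `v`
  have hUFD : ∀ x : X.left, UniqueFactorizationMonoid (X.left.presheaf.stalk x) := fun x ↦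
    Literature.AlgebraicGeometry.Resolution.Matsumura1987_20_3_holds _
      (isRegularLocalRing_stalk_of_smoothOfRelativeDimension X.hom n x)
  have hcompl : UW.compl = ⟨W, hW⟩ := by
    ext x
    change x ∈ (Wᶜ)ᶜ ↔ x ∈ W
    rw [compl_compl]
  have hpure : ∀ (V : X.left.Opens) (hV : IsAffineOpen V) [Nonempty V] (P : Ideal Γ(X.left, V)),
      P ∈ ((Scheme.IdealSheafData.vanishingIdeal UW.compl).ideal ⟨V, hV⟩).minimalPrimes →
        P.height = 1 := by
    intro V hV _ P hP
    rw [hcompl] at hP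
    exact height_eq_one_of_mem_minimalPrimes_of_isGenericPoint hW hgen hη V hV P hP
  obtain ⟨c, hvc⟩ := ComplementDivisor.exists_chart_of_pure hUFD hpure v
  have hηc : hWi.genericPoint ∈ c.W := (hgen.specializes hv).mem_open c.W.isOpen hvc
  -- the exceptional set `Z₁ ⊆ W` of codimension `≥ 2` off which `W(ℂ)` is straightened
  have hW1 : ∀ w ∈ W, ((1 : ℕ) : ℕ∞) ≤ Order.coheight w := fun w hw ↦ by
    rw [Nat.cast_one, ← hη]
    exact Order.coheight_anti (Scheme.le_iff_specializes.2 (hgen.specializes hw))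
  obtain ⟨Z₁, hZ₁, -, hcZ₁, hstr⟩ := GAGADimension.exists_closed_straightening_off hX hW hW1
  have hcZ₁' : ∀ z ∈ Z₁, ((2 : ℕ) : ℕ∞) ≤ Order.coheight z := fun z hz ↦ hcZ₁ z hz
  have hηZ₁ : hWi.genericPoint ∉ Z₁ := by
    intro h
    have h2 : ((2 : ℕ) : ℕ∞) ≤ Order.coheight hWi.genericPoint := hcZ₁' _ h
    rw [hη] at h2
    exact absurd (by exact_mod_cast h2 : (2 : ℕ) ≤ 1) (by omega)
  -- the normal coordinate near a simple point, and the topological core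
  obtain ⟨K₀, e₀, s₀, cf, he₀, he₀W, hs₀, hs₀W, hcf, hcf0, hfe⟩ :=
    exists_normalCoordinate_of_chart hX hW hWi hη c hηc hZ₁ hcZ₁'
  have hle := ker_restrictCompl_le_of_normalCoordinate hX hW hWi hZ₁ hstr c.W
    ⟨hWi.genericPoint, hgen.mem, hηc, hηZ₁⟩ (AlgPoints.continuousOn_evalOrZero c.W c.j)
    (fun P hP ↦ by
      rw [evalOrZero_chart_eq_zero_iff c hP]
      change ¬ (P.pt ∉ W) ↔ P.pt ∈ W
      rw [not_not])
    e₀ he₀ he₀W hs₀ hs₀W hcf hcf0 hfe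
  -- remove `Z₁`: additivity of supports and semipurity in codimension `2`
  refine ⟨c.W, hvc, hle.trans ?_⟩
  refine (ker_restrictCompl_union_le hX c.W.isOpen.isClosed_compl hZ₁ (c := 2)
    (fun t ht ↦ hcZ₁' t ht.2) (i := 2) (by norm_num)).trans (sup_le le_rfl ?_)
  intro x hx
  have hinj := injective_restrictCompl_of_le_coheight hX hZ₁ hcZ₁' (i := 2) (by norm_num)
  have h0 : x = 0 := hinj (by rw [LinearMap.mem_ker.1 hx, map_zero])
  rw [h0]
  exact Submodule.zero_mem _

end HodgeTheory

end Literature.AlgebraicGeometry.HodgeTheory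

end
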